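import Mathlib.NumberTheory.Padics.RingHoms
import Mathlib.Algebra.Module.LinearMap.Defs
import HarnessLib

/-!
# An additive map into a `p`-adically separated `ℤ_p`-module is `ℤ_p`-linear

Topic `Literature/RingTheory/AdicTopology`. The standard automatic-linearity principle (Atiyah–Macdonald Ch. 10, Krull's intersection
theorem context): if `M` is a `ℤ_p`-module with `⋂ₙ pⁿM = 0` (`p`-adically separated) and `f : T → M` is an additive map out of any
`ℤ_p`-module `T`, then `f` is `ℤ_p`-linear — for `a ∈ ℤ_p` and its integer approximations `aₙ ≡ a (mod pⁿ)` one has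
`f(a τ) − a f(τ) = f(pⁿ b τ) − pⁿ b f(τ) ∈ pⁿM` for every `n`.

* `AddMonoidHom.map_padicInt_smul_of_separated`, `AddMonoidHom.toPadicIntLinearOfSeparated`.

Used for the period maps of Tate modules (`T_pŴ → B_dR⁺`, `PAdicHodge/AinfWeierstrassTateModule`): additivity on `[p]`-compatible sequences
plus `p`-adic separatedness of the target lattice give `ℤ_p`-linearity. Nothing specific to elliptic curves is proved here.

## References
* M. F. Atiyah, I. G. Macdonald, *Introduction to Commutative Algebra* (1969), Ch. 10 (completions; Krull's theorem 10.17). [AtiyahMacdonald1969]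
-/

namespace Literature.RingTheory.AdicTopology

variable {p : ℕ} [Fact p.Prime] {T : Type*} [AddCommGroup T] [Module ℤ_[p] T] {M : Type*} [AddCommGroup M] [Module ℤ_[p] M]

/-- **An additive map into a `p`-adically separated `ℤ_p`-module commutes with the `ℤ_p`-action.** Hypothesis `hM`: an element of `M`
divisible by every power of `p` is `0`. [cite: AtiyahMacdonald1969, Ch. 10 Cor. 10.19] -/
theorem AddMonoidHom.map_padicInt_smul_of_separated
    (hM : ∀ x : M, (∀ n : ℕ, ∃ y : M, x = ((p : ℤ_[p]) ^ n) • y) → x = 0) (f : T →+ M) (a : ℤ_[p]) (τ : T) :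
    f (a • τ) = a • f τ := by
  rw [← sub_eq_zero]
  refine hM _ fun n => ?_
  -- `a = aₙ + pⁿ b` with `aₙ ∈ ℕ`
  obtain ⟨b, hb⟩ := Ideal.mem_span_singleton'.mp (PadicInt.appr_spec n a)
  have ha : a = (PadicInt.appr a n : ℤ_[p]) + b * (p : ℤ_[p]) ^ n := by
    rw [hb]; ring
  refine ⟨f (b • τ) - b • f τ, ?_⟩
  have hnat : f ((PadicInt.appr a n : ℤ_[p]) • τ) = (PadicInt.appr a n : ℤ_[p]) • f τ := by
    rw [Nat.cast_smul_eq_nsmul, Nat.cast_smul_eq_nsmul, map_nsmul]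
  have hpow : f ((b * (p : ℤ_[p]) ^ n) • τ) = ((p : ℤ_[p]) ^ n) • f (b • τ) := by
    rw [mul_comm, mul_smul]
    have : ((p : ℤ_[p]) ^ n) • (b • τ) = (p ^ n : ℕ) • (b • τ) := by
      rw [← Nat.cast_smul_eq_nsmul ℤ_[p], Nat.cast_pow]
    rw [this, map_nsmul, ← Nat.cast_smul_eq_nsmul ℤ_[p], Nat.cast_pow]
  rw [ha, add_smul, map_add, hnat, hpow, add_smul, smul_sub, mul_comm b, mul_smul]
  abel

/-- **The `ℤ_p`-linear map underlying an additive map into a `p`-adically separated `ℤ_p`-module.**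
[cite: AtiyahMacdonald1969, Ch. 10 Cor. 10.19] -/
def AddMonoidHom.toPadicIntLinearOfSeparated
    (hM : ∀ x : M, (∀ n : ℕ, ∃ y : M, x = ((p : ℤ_[p]) ^ n) • y) → x = 0) (f : T →+ M) : T →ₗ[ℤ_[p]] M :=
  { f with map_smul' := fun a τ => AddMonoidHom.map_padicInt_smul_of_separated hM f a τ }

/-- Unfolding. [cite: AtiyahMacdonald1969, Ch. 10 Cor. 10.19] -/
@[simp] theorem AddMonoidHom.toPadicIntLinearOfSeparated_apply
    (hM : ∀ x : M, (∀ n : ℕ, ∃ y : M, x = ((p : ℤ_[p]) ^ n) • y) → x = 0) (f : T →+ M) (τ : T) :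
    AddMonoidHom.toPadicIntLinearOfSeparated hM f τ = f τ := rfl

end Literature.RingTheory.AdicTopology
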